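import Literature.Probability.LatticeModels.LatticeBootstrapFeasible
import Literature.Probability.LatticeModels.CriticalGibbsUniqueness
import Literature.Probability.LatticeModels.MessagerMiracleSole
import Literature.Probability.LatticeModels.GKSInequalities
import HarnessLib

/-!
# Boundary-law mixture functionals: plus domination, nesting of levels, and the critical Gibbs face

Topic `Probability/LatticeModels`, namespace `Literature.Probability.LatticeModels`. Theorem-only
file (no definitions, no named facts): proved API of `boundaryLawFunctional`
(`LatticeBootstrapFeasible.lean`), the level-`L` Gibbs-inside mixture functional
`E_ν(A) = ∫ ⟨σ_A⟩^η_{B(L);β,0} ν(dη)` of a boundary law `ν`.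

(1) **Domination by the plus boundary condition** (any `d`, `β ≥ 0`): for a probability boundary
law and `A ⊆ B(L)`, `E_ν(A) ≤ ⟨σ_A⟩⁺_{B(L);β,0}` — every fixed boundary condition is dominated by
`+` on spin products (Friedli–Velenik 2017, Exercise 3.31: `|K'_e| ≤ K_e` comparison; tree theorem
`isingCorr_le_isingCorr_plus`), and the bound integrates. So boundary laws can only LOWER box
correlations below the plus-boundary ones; the lattice-bootstrap question (Cho–Sun 2023) is how far.

(2) **Nesting of levels** (any `d`, `β`): for `L' ≤ L` the level-`L` functional of a boundary
law `ν` IS the level-`L'` functional of the resampled law `ν γ_{B(L)}` (consistency of the Ising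
specification, Friedli–Velenik 2017, Lemma 6.7: `γ_{B(L)} γ_{B(L')} = γ_{B(L)}`), and a
probability boundary law resamples to a probability boundary law. Hence the families
`{E_ν : ν}` of level-`L` functionals are NESTED, decreasing in `L`: anything asserted of all
level-`L'` functionals holds for all level-`L` functionals, `L ≥ L'` (on sets inside `B(L')`; the
rows `LatticeBootstrapFeasible` are themselves monotone in the level,
`LatticeBootstrapFeasible.of_le`).

(3) **The critical Gibbs face on `ℤ³`.** For `ν` an infinite-volume GIBBS measure, `E_ν` is the
correlation functional of `ν` itself (DLR fixed point, Friedli–Velenik 2017, §6.2, eq. (6.12):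
`boundaryLawFunctional_eq_spinCorr_of_isGibbsMeasure`); at `β_c(3)` the Gibbs measure is unique
(Aizenman–Duminil-Copin–Sidoravicius 2015: continuity of the magnetisation, hence
`𝒢(β_c, 0) = {μ⁺_{β_c}}`; tree theorem `hasUniqueGibbsMeasure_criticalBeta_holds`), so every
Gibbs boundary law gives back the plus correlations `plusCorr 3 β_c 0` and in particular the
critical two-point function `criticalTwoPoint 3` on pairs — at EVERY level `L`, with no error
term. (For the lattice-bootstrap reading: the Gibbs face of the feasible set of Cho–Sun 2023,
Def. 11–12, consists of exact copies of the bulk state.)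

* `boundaryLawFunctional_le_isingCorr_plus` — (1).
* `IsSpecification.integral_integral_eq_of_subset` (consistency for observables, any
  specification), `boundaryLawFunctional_eq_of_le`, `isProbabilityMeasure_bind_isingSpecification`,
  `LatticeBootstrapFeasible.of_le` — (2).
* `boundaryLawFunctional_criticalBeta_eq_plusCorr_of_isGibbsMeasure` — (3), all finite `A`.
* `boundaryLawFunctional_criticalBeta_pair_eq_criticalTwoPoint` — pairs `{0, x}`, `x ≠ 0`.

## References

* M. Aizenman, H. Duminil-Copin, V. Sidoravicius, Comm. Math. Phys. 334 (2015) 719–742, Thm. 1.2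
  [AizenmanDuminilCopinSidoraviciusCMP2015].
* S. Friedli, Y. Velenik, *Statistical Mechanics of Lattice Systems* (2017), §6.2 eq. (6.12),
  Lemma 6.7, Exercise 3.31 [FriedliVelenik2017].
* H.-O. Georgii, *Gibbs Measures and Phase Transitions* (2011), Def. 1.23 (iii) [Georgii2011].
-/

namespace Literature.Probability.LatticeModels

open _root_.MeasureTheory _root_.ProbabilityTheory

/-- **Boundary laws are dominated by the plus boundary condition**: for `β ≥ 0`, a probability
boundary law `ν` and `A ⊆ B(L)`, `boundaryLawFunctional d L β ν A ≤ ⟨σ_A⟩⁺_{B(L);β,0}`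
(pointwise `⟨σ_A⟩^η_{B(L)} ≤ ⟨σ_A⟩⁺_{B(L)}`, Friedli–Velenik 2017, Exercise 3.31, integrated
against `ν`). [cite: FriedliVelenik2017, Exercise 3.31, p. 142] -/
theorem boundaryLawFunctional_le_isingCorr_plus {d : ℕ} {β : ℝ} (hβ : 0 ≤ β) (L : ℕ)
    (ν : Measure (SpinConfig (Site d))) [IsProbabilityMeasure ν] {A : Finset (Site d)}
    (hA : A ⊆ box d L) :
    boundaryLawFunctional d L β ν A ≤ isingCorr (zdGraph d) (box d L) β 0 .plus A := by
  rw [boundaryLawFunctional_apply]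
  have hle : ∀ η : SpinConfig (Site d), isingCorr (zdGraph d) (box d L) β 0 (.fixed η) A ≤
      isingCorr (zdGraph d) (box d L) β 0 .plus A :=
    fun η => isingCorr_le_isingCorr_plus (zdGraph d) hβ le_rfl (.fixed η) hA
  have hint : Integrable (fun η : SpinConfig (Site d) =>
      isingCorr (zdGraph d) (box d L) β 0 (.fixed η) A) ν :=
    Integrable.of_bound (measurable_isingCorr_fixed_box L β A).aestronglyMeasurable 1
      (Filter.Eventually.of_forall fun η => by
        rw [Real.norm_eq_abs]; exact abs_isingCorr_le_one (zdGraph d) (box d L) β 0 _ A)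
  calc ∫ η, isingCorr (zdGraph d) (box d L) β 0 (.fixed η) A ∂ν
      ≤ ∫ _η, isingCorr (zdGraph d) (box d L) β 0 .plus A ∂ν :=
        integral_mono hint (integrable_const _) hle
    _ = isingCorr (zdGraph d) (box d L) β 0 .plus A := by simp

/-! ### Nesting of levels -/

/-- **Consistency of a specification for observables** (Georgii 2011, Def. 1.23 (iii);
Friedli–Velenik 2017, Lemma 6.7): for `Λ ⊆ Λ'` and a `γ_{Λ'}(·|η)`-integrable real observable
`f`, `∫ (∫ f dγ_Λ(·|σ)) dγ_{Λ'}(·|η)(σ) = ∫ f dγ_{Λ'}(·|η)` (the set-wise field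
`IsSpecification.consistent` in monadic form, then Mathlib `Kernel.integral_comp`).
[cite: Georgii2011, Def. 1.23 (iii) (consistency)] -/
theorem IsSpecification.integral_integral_eq_of_subset {V S : Type*} [MeasurableSpace S]
    {γ : Specification V S} (hγ : IsSpecification γ) {Λ Λ' : Finset V} (h : Λ ⊆ Λ')
    (η : V → S) {f : (V → S) → ℝ} (hf : Integrable f (γ Λ' η)) :
    ∫ σ, ∫ τ, f τ ∂(γ Λ σ) ∂(γ Λ' η) = ∫ τ, f τ ∂(γ Λ' η) := by
  let κ : Kernel (V → S) (V → S) := ⟨γ Λ, hγ.measurable_fun Λ⟩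
  have hbind : (γ Λ' η).bind (γ Λ) = γ Λ' η := by
    ext A hA
    rw [Measure.bind_apply hA (hγ.measurable_fun Λ).aemeasurable]
    exact hγ.consistent h η A hA
  have hcomp : (κ ∘ₖ Kernel.const Unit (γ Λ' η)) () = γ Λ' η := by
    rw [Kernel.comp_apply, Kernel.const_apply]
    exact hbind
  have hfi : Integrable f ((κ ∘ₖ Kernel.const Unit (γ Λ' η)) ()) := by rwa [hcomp]
  have key := Kernel.integral_comp hfi
  rw [hcomp, Kernel.const_apply] at key
  exact key.symm

/-- **Resampling a probability boundary law inside a box gives a probability boundary law**: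
`ν γ_{B(L)}` (`= ν.bind (isingSpecification … (box d L))`) is a probability measure
(Friedli–Velenik 2017, §6.3.1, `μπ_Λ ∈ ℳ₁`). [cite: FriedliVelenik2017, §6.3.1] -/
theorem isProbabilityMeasure_bind_isingSpecification {d : ℕ} (β : ℝ) (L : ℕ)
    (ν : Measure (SpinConfig (Site d))) [IsProbabilityMeasure ν] :
    IsProbabilityMeasure (ν.bind (isingSpecification (zdGraph d) β 0 (box d L))) := by
  have hγ : IsSpecification (isingSpecification (zdGraph d) β 0) :=
    isSpecification_isingSpecification_zd_holds d β 0
  let κ : Kernel (SpinConfig (Site d)) (SpinConfig (Site d)) :=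
    ⟨isingSpecification (zdGraph d) β 0 (box d L), hγ.measurable_fun _⟩
  haveI : IsMarkovKernel κ := ⟨fun a => hγ.isProbability _ a⟩
  have hcomp : (κ ∘ₖ Kernel.const Unit ν) () = ν.bind (isingSpecification (zdGraph d) β 0 (box d L)) := by
    rw [Kernel.comp_apply, Kernel.const_apply]
    rfl
  have hP : IsProbabilityMeasure ((κ ∘ₖ Kernel.const Unit ν) ()) := inferInstance
  rwa [hcomp] at hP

/-- **Nesting of levels**: for `L' ≤ L`, a probability boundary law `ν` and every finite `A`,
`boundaryLawFunctional d L β ν A = boundaryLawFunctional d L' β (ν γ_{B(L)}) A` — the level-`L`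
functional of `ν` is the level-`L'` functional of the resampled law (iterated integral over the
bind, then consistency `γ_{B(L)} γ_{B(L')} = γ_{B(L)}` of the Ising specification,
Friedli–Velenik 2017, Lemma 6.7). [cite: FriedliVelenik2017, Lemma 6.7 (compatibility of the finite-volume Gibbs kernels)] -/
theorem boundaryLawFunctional_eq_of_le {d : ℕ} {L' L : ℕ} (hL : L' ≤ L) (β : ℝ)
    (ν : Measure (SpinConfig (Site d))) [IsProbabilityMeasure ν] (A : Finset (Site d)) :
    boundaryLawFunctional d L β ν A =
      boundaryLawFunctional d L' β (ν.bind (isingSpecification (zdGraph d) β 0 (box d L))) A := by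
  have hγ : IsSpecification (isingSpecification (zdGraph d) β 0) :=
    isSpecification_isingSpecification_zd_holds d β 0
  let κ : Kernel (SpinConfig (Site d)) (SpinConfig (Site d)) :=
    ⟨isingSpecification (zdGraph d) β 0 (box d L), hγ.measurable_fun _⟩
  haveI : IsMarkovKernel κ := ⟨fun a => hγ.isProbability _ a⟩
  have hcomp : (κ ∘ₖ Kernel.const Unit ν) () = ν.bind (isingSpecification (zdGraph d) β 0 (box d L)) := by
    rw [Kernel.comp_apply, Kernel.const_apply]
    rfl
  rw [boundaryLawFunctional_eq_integral_spinCorr, boundaryLawFunctional_eq_integral_spinCorr, ← hcomp]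
  -- the integrand of the right-hand side is bounded and measurable
  have hint : Integrable (fun σ : SpinConfig (Site d) =>
      spinCorr (isingSpecification (zdGraph d) β 0 (box d L') σ) A) ((κ ∘ₖ Kernel.const Unit ν) ()) :=
    Integrable.of_bound (measurable_isingCorr_fixed_box L' β A).aestronglyMeasurable 1
      (Filter.Eventually.of_forall fun σ => by
        rw [Real.norm_eq_abs]
        exact abs_isingCorr_le_one (zdGraph d) (box d L') β 0 _ A)
  rw [Kernel.integral_comp hint, Kernel.const_apply]
  refine integral_congr_ae (Filter.Eventually.of_forall fun η => ?_)
  -- consistency for the observable `spinProduct A`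
  change ∫ s, spinProduct A s ∂(isingSpecification (zdGraph d) β 0 (box d L) η) =
    ∫ σ, ∫ s, spinProduct A s ∂(isingSpecification (zdGraph d) β 0 (box d L') σ)
      ∂(isingSpecification (zdGraph d) β 0 (box d L) η)
  haveI : IsProbabilityMeasure (isingSpecification (zdGraph d) β 0 (box d L) η) :=
    hγ.isProbability _ η
  exact (hγ.integral_integral_eq_of_subset (box_mono d hL) η (integrable_spinProduct _ A)).symm

/-- **The lattice-bootstrap rows are monotone in the level**: a functional feasible at level `L`
is feasible at every level `L' ≤ L` (each row only quantifies over sites / sets of the box, and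
`box 3 L' ⊆ box 3 L`; the Simon rows over `n ≤ L' ≤ L`) (Cho–Sun 2023, Def. 12: the level-`L`
constraints contain the level-`L'` ones). [cite: ChoSun2023, Def. 12] -/
theorem LatticeBootstrapFeasible.of_le {L' L : ℕ} {cw Cw : ℝ} {E : Finset (Site 3) → ℝ}
    (h : LatticeBootstrapFeasible L cw Cw E) (hL : L' ≤ L) : LatticeBootstrapFeasible L' cw Cw E := by
  have hb : box 3 L' ⊆ box 3 L := box_mono 3 hL
  obtain ⟨h1, h2, h3, h4, h5, h6, h7, h8⟩ := h
  refine ⟨fun A v hA hAv => h1 A v (hA.trans hb) (hAv.trans hb),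
    fun A π s hA => h2 A π s (hA.trans hb),
    fun θ ℓ hθ m A c hA => h3 θ ℓ hθ m A c fun a => ⟨(hA a).1.trans hb, (hA a).2⟩,
    fun A hA => h4 A (hA.trans hb),
    fun x i hx hxi hxL hxL' => h5 x i hx hxi (hb hxL) (hb hxL'),
    fun x i j hij hx hxji hxL hxL' => h6 x i j hij hx hxji (hb hxL) (hb hxL'),
    fun n hn hnL => h7 n hn (hnL.trans hL),
    fun x hxL hx => h8 x (hb hxL) hx⟩

/-! ### The critical Gibbs face -/

/-- **Gibbs boundary laws at `β_c(3)` give back the plus correlations at every level**: for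
`μ ∈ 𝒢(β_c(3), 0)` on `ℤ³`, every `L` and every finite `A`,
`boundaryLawFunctional 3 L β_c μ A = ⟨σ_A⟩⁺_{β_c,0}` (DLR fixed point + uniqueness of the critical
state). [cite: AizenmanDuminilCopinSidoraviciusCMP2015, Thm. 1.2 (uniqueness of the Gibbs state at β_c)] -/
theorem boundaryLawFunctional_criticalBeta_eq_plusCorr_of_isGibbsMeasure
    {μ : Measure (SpinConfig (Site 3))}
    (hμ : IsGibbsMeasure (isingSpecification (zdGraph 3) (criticalBeta 3) 0) μ) (L : ℕ)
    (A : Finset (Site 3)) :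
    boundaryLawFunctional 3 L (criticalBeta 3) μ A = plusCorr 3 (criticalBeta 3) 0 A := by
  rw [boundaryLawFunctional_eq_spinCorr_of_isGibbsMeasure hμ L]
  obtain ⟨μp, hμp, -, hcorr⟩ :=
    exists_plusMeasure_holds (d := 3) (β := criticalBeta 3) (h := (0 : ℝ)) (criticalBeta_nonneg 3)
  have huniq := hasUniqueGibbsMeasure_criticalBeta_holds (d := 3) (by norm_num)
  have hμmem : μ ∈ isingGibbsMeasures 3 (criticalBeta 3) 0 :=
    (mem_isingGibbsMeasures_iff 3 _ 0 μ).2 hμ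
  have hμeq : μ = μp := huniq.1 hμmem hμp
  subst hμeq
  exact hcorr A

/-- **Pairs**: for `μ ∈ 𝒢(β_c(3), 0)`, every `L` and `x ≠ 0`,
`boundaryLawFunctional 3 L β_c μ {0, x} = ⟨σ₀σ_x⟩⁺_{β_c(3)} = criticalTwoPoint 3 x`.
[cite: AizenmanDuminilCopinSidoraviciusCMP2015, Thm. 1.2] -/
theorem boundaryLawFunctional_criticalBeta_pair_eq_criticalTwoPoint
    {μ : Measure (SpinConfig (Site 3))}
    (hμ : IsGibbsMeasure (isingSpecification (zdGraph 3) (criticalBeta 3) 0) μ) (L : ℕ)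
    {x : Site 3} (hx : x ≠ 0) :
    boundaryLawFunctional 3 L (criticalBeta 3) μ {0, x} = criticalTwoPoint 3 x := by
  rw [boundaryLawFunctional_criticalBeta_eq_plusCorr_of_isGibbsMeasure hμ L, criticalTwoPoint,
    twoPointPlus_eq_plusCorr_pair _ hx]

end Literature.Probability.LatticeModels

namespace Literature.Probability.LatticeModels

open _root_.MeasureTheory Finset

/-! ### Feasibility depends only on the values of the functional on subsets of the box -/

/-- `{0, y} ⊆ box 3 L` for `y ∈ box 3 L`. [folklore] -/
theorem pair_subset_box_three {L : ℕ} {y : Site 3} (hy : y ∈ box 3 L) :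
    ({0, y} : Finset (Site 3)) ⊆ box 3 L := by
  intro z hz
  simp only [Finset.mem_insert, Finset.mem_singleton] at hz
  rcases hz with rfl | rfl
  · exact zero_mem_box 3 L
  · exact hy

/-- The box is invariant under signed coordinate permutations (the hyperoctahedral group of
Cho–Sun 2023, Def. 12, Symmetry). [cite: ChoSun2023, Def. 12 (Symmetry)] -/
theorem image_signedPerm_subset_box {L : ℕ} {A : Finset (Site 3)} (hA : A ⊆ box 3 L)
    (π : Equiv.Perm (Fin 3)) (s : Fin 3 → ℤˣ) :
    A.image (fun x i => (s i : ℤ) * x (π i)) ⊆ box 3 L := by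
  intro z hz
  obtain ⟨x, hx, rfl⟩ := Finset.mem_image.1 hz
  have hxb := (mem_box.1 (hA hx))
  rw [mem_box]
  intro i
  obtain ⟨h1, h2⟩ := hxb (π i)
  rcases Int.units_eq_one_or (s i) with hs | hs <;> simp [hs] <;> omega

/-- The four lattice mirrors of the reflection-positivity rows map the closed positive half-box
into the box (site plane `x_i = 0`, bond plane `x_i = 1/2`, diagonal and anti-diagonal planes;
Fröhlich–Israel–Lieb–Simon 1978 mirror types as in Cho–Sun 2023, Def. 12).
[cite: ChoSun2023, Def. 12 (Reflection positivity)] -/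
theorem mirror_mem_box {L : ℕ} {θ : Site 3 → Site 3} {ℓ : Site 3 → ℤ}
    (hθ : ∃ i j : Fin 3, i ≠ j ∧
      ((θ = fun x => Function.update x i (-x i)) ∧ (ℓ = fun x => x i) ∨
       (θ = fun x => Function.update x i (1 - x i)) ∧ (ℓ = fun x => 2 * x i - 1) ∨
       (θ = fun x => x ∘ Equiv.swap i j) ∧ (ℓ = fun x => x i - x j) ∨
       (θ = fun x => Function.update (Function.update x i (-x j)) j (-x i)) ∧
         (ℓ = fun x => x i + x j)))
    {p : Site 3} (hp : p ∈ box 3 L) (hℓ : 0 ≤ ℓ p) : θ p ∈ box 3 L := by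
  obtain ⟨i, j, hij, hcases⟩ := hθ
  have hpb := mem_box.1 hp
  rw [mem_box]
  intro k
  rcases hcases with ⟨rfl, rfl⟩ | ⟨rfl, rfl⟩ | ⟨rfl, rfl⟩ | ⟨rfl, rfl⟩ <;> dsimp only at hℓ ⊢
  · -- site mirror
    by_cases hk : k = i
    · subst hk; simp only [Function.update_self]; have := hpb k; omega
    · simp only [Function.update_of_ne hk]; exact hpb k
  · -- bond mirror: `2 p_i - 1 ≥ 0` forces `p_i ≥ 1`, so `1 - p_i ∈ [1-L, 0]`
    by_cases hk : k = i
    · subst hk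
      simp only [Function.update_self]
      have h1 := hpb k
      have h2 : 0 ≤ 2 * p k - 1 := hℓ
      omega
    · simp only [Function.update_of_ne hk]; exact hpb k
  · -- diagonal mirror
    exact hpb _
  · -- anti-diagonal mirror
    by_cases hkj : k = j
    · subst hkj; simp only [Function.update_self]; have := hpb i; omega
    · rw [Function.update_of_ne hkj]
      by_cases hki : k = i
      · subst hki; simp only [Function.update_self]; have := hpb j; omega
      · rw [Function.update_of_ne hki]; exact hpb k

/-- **The lattice-bootstrap rows only read `E` on subsets of the box**: if `E'` agrees with `E`
on every `A ⊆ box 3 L`, then `E` feasible at level `L` implies `E'` feasible at level `L`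
(every set evaluated by the rows of Cho–Sun 2023, Def. 12 — translates, signed permutations,
mirror images of half-box sets, pairs `{0, y}` with `y` in the box, Simon spheres `n ≤ L` — lies
in the box). [cite: ChoSun2023, Def. 12] -/
theorem LatticeBootstrapFeasible.congr {L : ℕ} {cw Cw : ℝ} {E E' : Finset (Site 3) → ℝ}
    (h : LatticeBootstrapFeasible L cw Cw E) (hEE' : ∀ A, A ⊆ box 3 L → E' A = E A) :
    LatticeBootstrapFeasible L cw Cw E' := by
  obtain ⟨h1, h2, h3, h4, h5, h6, h7, h8⟩ := h
  refine ⟨?_, ?_, ?_, ?_, ?_, ?_, ?_, ?_⟩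
  · intro A v hA hAv
    rw [hEE' _ hAv, hEE' _ hA]
    exact h1 A v hA hAv
  · intro A π s hA
    rw [hEE' _ (image_signedPerm_subset_box hA π s), hEE' _ hA]
    exact h2 A π s hA
  · intro θ ℓ hθ m A c hA
    have hsub : ∀ a b, symmDiff (A a) ((A b).image θ) ⊆ box 3 L := by
      intro a b z hz
      rcases Finset.mem_symmDiff.1 hz with ⟨hz1, -⟩ | ⟨hz2, -⟩
      · exact (hA a).1 hz1
      · obtain ⟨p, hp, rfl⟩ := Finset.mem_image.1 hz2
        exact mirror_mem_box hθ ((hA b).1 hp) ((hA b).2 p hp)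
    have hsum : ∑ a, ∑ b, c a * c b * E' (symmDiff (A a) ((A b).image θ)) =
        ∑ a, ∑ b, c a * c b * E (symmDiff (A a) ((A b).image θ)) :=
      Finset.sum_congr rfl fun a _ => Finset.sum_congr rfl fun b _ => by rw [hEE' _ (hsub a b)]
    rw [hsum]
    exact h3 θ ℓ hθ m A c hA
  · intro A hA
    rw [hEE' _ hA]
    exact h4 A hA
  · intro x i hx hxi hxL hxL'
    rw [hEE' _ (pair_subset_box_three hxL'), hEE' _ (pair_subset_box_three hxL)]
    exact h5 x i hx hxi hxL hxL'
  · intro x i j hij hx hxji hxL hxL'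
    rw [hEE' _ (pair_subset_box_three hxL'), hEE' _ (pair_subset_box_three hxL)]
    exact h6 x i j hij hx hxji hxL hxL'
  · intro n hn hnL
    have hsum : ∑ y ∈ box 3 n \ box 3 (n - 1), 24 * criticalBeta 3 * E' {0, y} =
        ∑ y ∈ box 3 n \ box 3 (n - 1), 24 * criticalBeta 3 * E {0, y} :=
      Finset.sum_congr rfl fun y hy => by
        rw [hEE' _ (pair_subset_box_three (box_mono 3 hnL (Finset.mem_sdiff.1 hy).1))]
    rw [hsum]
    exact h7 n hn hnL
  · intro x hxL hx
    rw [hEE' _ (pair_subset_box_three hxL)]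
    exact h8 x hxL hx

end Literature.Probability.LatticeModels
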